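import Summits.BirchSwinnertonDyer.Rank1Residual.AdditivePotMult.ChiEigenSelmerDual
import Summits.BirchSwinnertonDyer.Rank1Residual.AdditivePotMult.GeneratorNormalisation
import Summits.BirchSwinnertonDyer.Rank1Residual.AdditivePotMult.Twist
import Summits.BirchSwinnertonDyer.Rank1Residual.Additive.ChiBranchInputOdd
import HarnessLib

/-!
# [B∘C]@0 ⇐ [B]⁻@0: additive-p4's typed `χ_p`-branch input follows from a TWIST-FREE componentwise input on the semistable curve, by the kernel transport [C] — kernel brick 5 (modulo brick 4) (cell `b2b-bsdres`, seat additive-p1, gen 8)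

HONEST FRAMING (cell `b2b-bsdres`, run/shared/lean/b2b/bsd-rank1-residual/, verbatim in every
file): the goal of the cell is to DELETE the COMBINATION-SHAPED residual classes of the
Birch–Swinnerton-Dyer formula for ALL analytic-rank `≤ 1` elliptic curves over `ℚ` — "full BSD
formula for every rank `≤ 1` curve in class `C`" assembled STRICTLY from published theorems — so
that the rank-`≤ 1` remainder becomes exactly the CONSTRUCTION-SHAPED classes, which are TYPED
(missing-input `Prop`s), NOT attempted. This is not "finishing BSD". The additive sub-cell (seats
additive-p1…p4) is a RESEARCH ROUTE on the construction-shaped classes X3/X4; sub-cell additive-p1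
= the potentially MULTIPLICATIVE additive prime (X3♯(M) / X4(M)); no claim beyond the stated
classes; the labels of X3/X4 are UNCHANGED by this file; nothing is booked.

One TYPED predicate (a `def … : Prop` in the manner of `Additive/ChiBranchInputOdd.lean`: the
statement is a componentwise READING of a published theorem in a vocabulary — eigen-Selmer dual
data — whose Literature-side copy is still in review (`IwasawaSelmerEigen.lean`, p231357), so it
is typed here, under Summits, and NOTHING is asserted) and theorems. Context: design
HOME/b2b-bsdres-additive-p1/KERNEL-C-P3.md. After gen 7 the ONLY non-published input of the rank-0
upper half on X3♯(M)/X4(M) at an odd prime `p ≡ 3 (mod 4)` is additive-p4's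
`ChiBranchLeadingTermOddAt W p` = [B∘C]@0 — a statement about the ADDITIVE curve `W = V ⊗ χ_p`
over `ℚ_∞` whose unprinted half is the transport [C]. This generation put [C] in the kernel
(`PrimeToPDescent`, `TwistPointsOver`, `TwistTransportH1/Local`, `VariableChangeSelmerOver`,
`TwistDescent`, `ChiEigenSelmerDual`, `GeneratorNormalisation`). THIS FILE closes the loop:

* `EigenLeadingTermOddAt V K p` — [B]⁻@0, TYPED: for the `p`-SEMISTABLE curve `V` alone
  (good ordinary or multiplicative at `p`, `V[p]` reducible), `κ` cyclotomic with a topological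
  generator `γ ∈ Gal(ℚ̄/K)` matching the cyclotomic variable, `f` the newform of `V`, and ANY
  `Λ`-dual datum `D` of `Sel_{p^∞}(V/K·ℚ_∞)^{(χ_K)}`: `D.X` is torsion and some `g ∈ char D.X`
  has constant term `u·ϖ·∑_a (a/p)[a/p]⁻_f`. At `p = 3`, `K = ℚ(ζ₃)` its universal closure is the
  `e₋`-COMPONENT of Wuthrich 2014 Thm 16 / Kato 17.4(3) over `ℚ(μ_{3^∞})` with the MTT §I.14
  constant term — brick 4, to be filed as a Literature fact by the literature seat;
* `chiBranchLeadingTermOddAt_of_eigenLeadingTerm` — **for `p` odd, `K = ℚ(θ)` with `θ² = −p`: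
  (`EigenLeadingTermOddAt V K p` for every globally minimal `V` with `C • V^{(−p)} = W`) ⟹
  `ChiBranchLeadingTermOddAt W p`** — by generator normalisation (`exists_mul_mem_galRange`),
  re-labelling (`SelmerDualData.congrGen`), transport along [C] with the SAME `Λ`-module
  (`SelmerDualData.toChiEigen`), and `Red W p ↔ Red V p` (`irr_iff_of_model_twist`).

So the typed input of every gen-6/7 `p = 3` consumer (`ClassX3M.missingUpperBoundAt_three_rankZero_
of_chiBranchOdd[_of_shaAn_unit]`, `ClassX4M.…_three_…` via the big-image twin — the odd big-image
variant is the same argument, not in this file) is now reduced to a statement about `E♭` over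
`ℚ(μ_{3^∞})` containing NO twist and NO additive curve: the located gap of the rank-0 upper half
at `p = 3` on X3♯(M) (and X3♯(G-ord), additive-p2) is EXACTLY brick 4.

References: C. Wuthrich, Doc. Math. 19 (2014), §3 p. 390, Thm. 16 [Wuthrich2014]; K. Kato,
Astérisque 295 (2004), Thm. 17.4 [Kato2004]; B. Mazur, J. Tate, J. Teitelbaum, Invent. Math. 84
(1986), §I.13–I.14 [MazurTateTeitelbaum1986Invent]; R. Greenberg, LNM 1716 (1999), §5 p. 143
[GreenbergLNM1716].
-/

noncomputable section

open scoped Classical MatrixGroups ModularForm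

namespace Summit.BirchSwinnertonDyer.Rank1Residual.AdditivePotMult

open CongruenceSubgroup WeierstrassCurve Literature.NumberTheory.EllipticCurves
  Literature.NumberTheory.EllipticCurves.ModularForms
  Literature.NumberTheory.EllipticCurves.Rank1Residual Literature.NumberTheory.GaloisRepresentations
  Additive

/-! ## The typed input [B]⁻ at `T = 0`: the `e_χ`-component divisibility for the SEMISTABLE curve, with no twist in it -/

/-- **[B]⁻ at the trivial character, TYPED** — the `χ_K`-COMPONENT form of the input behind the
rank-`0` upper half on X3/X4 at an odd prime `p ≡ 3 (mod 4)`, stated for the `p`-SEMISTABLE curve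
`V = E♭` ALONE (no twist, no additive curve): for `V` good ordinary or multiplicative at `p` with
`V[p]` reducible, `κ` the cyclotomic `ℤ_p`-extension of `ℚ` with a topological generator
`γ ∈ Gal(ℚ̄/K)` matching the cyclotomic variable, `f` the newform of `V`, and ANY `Λ`-dual datum
`D` of the `χ_K`-eigenspace `Sel_{p^∞}(V/K·ℚ_∞)^{(χ_K)}` (`ChiEigenSelmerDualData`, file
`ChiEigenSelmerDual`; for `K = ℚ(√−3)`, `p = 3`: the `ω`-eigenspace of `Sel_{3^∞}(V/ℚ(μ_{3^∞}))`):
`D.X` is `Λ`-torsion and SOME `g ∈ char_Λ D.X` has constant term `u · ϖ · ∑_{a mod p} (a/p)[a/p]⁻_f`,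
`u ∈ ℤ_pˣ`. Its universal closure at `p = 3`, `K = ℚ(ζ₃)` is the `e₋`-COMPONENT of C. Wuthrich,
Doc. Math. 19 (2014) Thm. 16 ("`char_Λ X(E)` divides the ideal generated by `L_p(E)`" in
`Λ = ℤ_p[Δ]⟦Γ⟧ = ⊕_i Λ(Γ)e_i`, §3 p. 390; reducible, semistable) resp. of Kato 2004 Thm. 17.4(3)
(surjective), with the `T = 0` value of the `ω`-branch by Mazur–Tate–Teitelbaum §I.13–I.14 — a
PRINTED statement read componentwise (the readings A92/A99/A107/A108 of the cell multiply the
components). A predicate on `(V, K, p)`; NOTHING is asserted here (brick 4 of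
HOME/b2b-bsdres-additive-p1/KERNEL-C-P3.md files it as a Literature fact in the vocabulary
`EigenSelmerDualData` of `Literature/…/IwasawaSelmerEigen.lean`).
[cite: Wuthrich2014, Thm. 16 and §3 p. 390 (shape only; nothing asserted)]
[cite: MazurTateTeitelbaum1986Invent, §I.13–I.14 (shape only; nothing asserted)] -/
def EigenLeadingTermOddAt (V : WeierstrassCurve ℚ) (K : Type) [Field K] [NumberField K]
    [(galRange (K := ℚ) K).Normal] (p : ℕ) [Fact p.Prime] : Prop :=
  ∀ [V.IsElliptic] [V.IsGloballyMinimal] {κ : ZpExtension ℚ p} {γ : Field.absoluteGaloisGroup ℚ}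
    {N : ℕ} [NeZero N] {f : CuspForm (Gamma0 N) 2},
    p % 4 = 3 → (GoodOrd V p ∨ Mult V p) → Red V p →
    κ.IsCyclotomic → κ.IsTopGenerator γ → IsCyclotomicVariable p γ →
    γ ∈ galRange (K := ℚ) K → IsNewformOf V f →
    ∀ (D : ChiEigenSelmerDualData V K κ γ) (ϖ : ℚ), (ϖ : ℝ) * V.imaginaryPeriodRat = minusPeriod f →
      Module.IsTorsion (IwasawaAlgebra p) D.X ∧
      ∃ g ∈ Literature.NumberTheory.EllipticCurves.Module.charIdeal (IwasawaAlgebra p) D.X,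
        ∃ u : ℤ_[p]ˣ,
          ((PowerSeries.constantCoeff g : ℤ_[p]) : ℚ_[p]) =
            ((u : ℤ_[p]) : ℚ_[p]) * (ϖ : ℚ_[p]) * (legendreMinusSymbolSum f p : ℚ_[p])

/-! ## Transfer of the cyclotomic-variable hypothesis along `γ ↦ γ g₀` -/

/-- For `κ` cyclotomic, `g₀ ∈ ker κ` has torsion cyclotomic character. [folklore] -/
theorem isOfFinOrder_cyclotomicCharacter_of_mem_kerSubgroup {p : ℕ} [Fact p.Prime]
    {κ : ZpExtension ℚ p} (hκ : κ.IsCyclotomic) {g₀ : Field.absoluteGaloisGroup ℚ}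
    (hg₀ : g₀ ∈ κ.kerSubgroup) :
    IsOfFinOrder (GaloisRep.cyclotomicCharacter ℚ p g₀) := by
  rw [ZpExtension.IsCyclotomic] at hκ
  rw [hκ, Subgroup.mem_comap] at hg₀
  exact (CommGroup.mem_torsion _).mp hg₀

/-- `IsCyclotomicVariable` is insensitive to `γ ↦ γ g₀`, `g₀ ∈ ker κ` (`κ` cyclotomic): the
torsion unit `ζ` absorbs `χ_cyc(g₀)`. [folklore] -/
theorem isCyclotomicVariable_mul {p : ℕ} [Fact p.Prime] {κ : ZpExtension ℚ p} (hκ : κ.IsCyclotomic)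
    {γ g₀ : Field.absoluteGaloisGroup ℚ} (hγ : IsCyclotomicVariable p γ) (hg₀ : g₀ ∈ κ.kerSubgroup) :
    IsCyclotomicVariable p (γ * g₀) := by
  obtain ⟨ζ, hζ, hγζ⟩ := hγ
  refine ⟨(GaloisRep.cyclotomicCharacter ℚ p g₀)⁻¹ * ζ,
    (Commute.all _ _).isOfFinOrder_mul
      (isOfFinOrder_cyclotomicCharacter_of_mem_kerSubgroup hκ hg₀).inv hζ, ?_⟩
  rw [map_mul, ← hγζ]
  congr 1
  rw [mul_assoc, ← mul_assoc (GaloisRep.cyclotomicCharacter ℚ p g₀), mul_inv_cancel, one_mul]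

/-! ## [B∘C]@0 from [B]⁻@0 and the kernel transport -/

/-- **`ChiBranchLeadingTermOddAt W p` FROM the twist-free componentwise input** (kernel bricks
1–3 + generator normalisation): for an odd prime `p`, a quadratic field `K = ℚ(θ)` with
`θ² = −p` (so `K = ℚ(√p*)` for `p ≡ 3 (mod 4)`), and a curve `W/ℚ`, IF every globally minimal
`V` with `C • V^{(−p)} = W` satisfies `EigenLeadingTermOddAt V K p`, THEN
`ChiBranchLeadingTermOddAt W p` (additive-p4's typed input [B∘C] at `T = 0`, file
`Additive/ChiBranchInputOdd.lean`). Proof: given the data of `ChiBranchLeadingTermOddAt` and a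
dual datum `D` of `Sel_{p^∞}(W/ℚ_∞)` for `(κ, γ)`, move `γ` into `Gal(ℚ̄/K)` by an element of
`ker κ` (`exists_mul_mem_galRange`; same action, same `κ`-value, still matching the cyclotomic
variable), re-label `D` (`SelmerDualData.congrGen`), transport it along [C] to a
`ChiEigenSelmerDualData` of `V` with the SAME `Λ`-module (`SelmerDualData.toChiEigen`), apply the
input, and read the conclusion back on `D` (`charIdeal`, `IsTorsion` are literally the same).
Hence, once brick 4 (the componentwise Wuthrich/Kato reading at `p = 3`) discharges
`EigenLeadingTermOddAt V ℚ(ζ₃) 3` for `Mult V 3` / `GoodOrd V 3`, ALL gen-6/7 `p = 3` consumers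
fire class-wide. [folklore] -/
theorem chiBranchLeadingTermOddAt_of_eigenLeadingTerm (W : WeierstrassCurve ℚ) (p : ℕ)
    [Fact p.Prime] (K : Type) [Field K] [NumberField K] [(galRange (K := ℚ) K).Normal]
    (h2 : Module.finrank ℚ K = 2) {θ : K} (hθ : θ ∉ Set.range (algebraMap ℚ K))
    (hc : θ ^ 2 = algebraMap ℚ K (-(p : ℚ)))
    (h : ∀ (V : WeierstrassCurve ℚ) [V.IsElliptic] [V.IsGloballyMinimal],
      (∃ C : VariableChange ℚ, C • V.quadraticTwist (-(p : ℚ)) = W) → EigenLeadingTermOddAt V K p) :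
    ChiBranchLeadingTermOddAt W p := by
  intro V _ _ κ γ N _ f hp4 hCW hVp hred hκ hγ hcyc hf D ϖ hϖ
  obtain ⟨C, hCW'⟩ := hCW
  have hp2 : p ≠ 2 := by rintro rfl; norm_num at hp4
  have hpQ : (-(p : ℚ)) ≠ 0 := neg_ne_zero.mpr (Nat.cast_ne_zero.mpr (Fact.out : p.Prime).ne_zero)
  haveI : (V.quadraticTwist (-(p : ℚ))).IsElliptic := isElliptic_quadraticTwist V hpQ
  haveI : W.IsElliptic := by rw [← hCW']; infer_instance
  -- move the generator into `Gal(ℚ̄/K)`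
  obtain ⟨g₀, hg₀, hγ'U, hconj, -⟩ := exists_mul_mem_galRange W K h2 hθ hc κ hp2 γ
  have hγ' : κ.IsTopGenerator (γ * g₀) := isTopGenerator_mul_of_mem_kerSubgroup κ hγ hg₀
  have hcyc' : IsCyclotomicVariable p (γ * g₀) := isCyclotomicVariable_mul hκ hcyc hg₀
  -- re-label and transport the dual datum
  let D' : W.SelmerDualData κ (γ * g₀) := SelmerDualData.congrGen W κ hconj D
  let Dχ : ChiEigenSelmerDualData V K κ (γ * g₀) :=
    SelmerDualData.toChiEigen V K h2 hθ hc p κ hCW' hγ'U hp2 D'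
  -- reducibility of `V[p]` from that of `W[p]`
  have hredV : Red V p := fun hirrV ↦
    hred ((irr_iff_of_model_twist (W := V) (p := p) hpQ ⟨C, hCW'⟩).mpr hirrV)
  -- apply the twist-free input
  obtain ⟨htor, g, hg, u, hu⟩ := h V ⟨C, hCW'⟩ hp4 hVp hredV hκ hγ' hcyc' hγ'U hf Dχ ϖ hϖ
  exact ⟨htor, g, hg, u, hu⟩

end Summit.BirchSwinnertonDyer.Rank1Residual.AdditivePotMult

end
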